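import Summits.AtomisticToContinuum.Crystallization.Theorems.ChartedZeroExcessLayeredLatticeLiouvilleZC

/-!
# Part ZD «HexagonKernel» (lens-2 g77 rider; first piece of the (GL) attack ruled as g78's target, critic row 1377 (iv))

Configuration-free, `decide`-scale combinatorics of the triangular lattice in Löschian coordinates `ℤ × ℤ`
(site `(a, b)` ↦ `a•u + b•v` of a close-packed layer).  The six neighbours of `0` are `loDir k`, `k : Fin 6`, in cyclic
order; two of them are adjacent iff their indices are cyclically adjacent (`loAdj_loDir_iff`).

* `dihedral_of_cycHom` — an injective map `Fin 6 → Fin 6` preserving cyclic adjacency is a rotation or a reflection.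
* `loRot j ε` — the twelve point-group maps of the triangular lattice as explicit `ℤ`-linear maps of `ℤ × ℤ`
  (`loRot_loDir_true/false`: `loRot j true (loDir k) = loDir (j + k)`, `loRot j false (loDir k) = loDir (j - k)`).
* ★ `hexagon_rigidity` — THE HEXAGON KERNEL: a map `f : ℤ × ℤ → ℤ × ℤ` with `f 0 = 0` sending the six neighbours of `0`
  injectively to neighbours of `0` and preserving adjacency among them agrees on the star of `0` with one of the twelve
  point-group maps.
* `loRot_ext_pair`, `affine_pinning` — PINNING: a point-group(-affine) map is determined by its values on a lattice
  triangle.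
* ★★ `lattice_rigidity` / `lattice_rigidity_exists` — PROPAGATION: a map bond-preserving and injective on `R ⊆ ℤ × ℤ` is
  the restriction of ONE point-group-affine map (a lattice isometry) on the union of the closed stars of any family of centres
  connected through bonds whose closed stars lie in `R` (`StarAdj R`) — no holonomy condition, annuli included.  This is the
  configuration-free half of (GL) `BondLabelP` (NODE 77, tree `…LatticeLiouvilleZC`; critic row 1377 (iv)); the other half is
  letter bookkeeping across layers via `straddle_dichotomy_*`.

0 sorry; standard axioms.  Pure combinatorics: no door-set hypothesis enters.
-/

namespace Summit.AtomisticToContinuum.Crystallization.Theorems.ChartedZeroExcessLayeredLatticeLiouville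

/-! ### ZD-1  The dihedral lemma on `Fin 6` -/

/-- Cyclic adjacency on `Fin 6` (an `abbrev`, so that it is decidable by unfolding — no instance declared). -/
abbrev CycAdj (a b : Fin 6) : Prop := b = a + 1 ∨ b = a - 1

/-- `cycAdj_symm` (docstring added by the landing lane; see the module docstring). [formal bookkeeping] -/
theorem cycAdj_symm {a b : Fin 6} (h : CycAdj a b) : CycAdj b a := by
  revert a b; decide

/-- `cycAdj_succ` (docstring added by the landing lane; see the module docstring). [formal bookkeeping] -/
theorem cycAdj_succ (k : Fin 6) : CycAdj k (k + 1) := Or.inl rfl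

/-- One step of a non-backtracking walk keeps its direction: `c - b = b - a`. -/
theorem cycAdj_step (a b c : Fin 6) (h1 : CycAdj a b) (h2 : CycAdj b c) (h3 : a ≠ c) :
    c = b + (b - a) := by
  revert a b c; decide

/-- An injective, cyclic-adjacency-preserving self-map of `Fin 6` is dihedral (a rotation or a reflection). -/
theorem dihedral_of_cycHom (g : Fin 6 → Fin 6) (hinj : Function.Injective g)
    (hadj : ∀ k : Fin 6, CycAdj (g k) (g (k + 1))) :
    (∀ k, g k = g 0 + k) ∨ (∀ k, g k = g 0 - k) := by
  have ne : ∀ i j : Fin 6, i ≠ j → g i ≠ g j := fun i j h e => h (hinj e)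
  have s01 : CycAdj (g 0) (g 1) := hadj 0
  have s12 : CycAdj (g 1) (g 2) := hadj 1
  have s23 : CycAdj (g 2) (g 3) := hadj 2
  have s34 : CycAdj (g 3) (g 4) := hadj 3
  have s45 : CycAdj (g 4) (g 5) := hadj 4
  have t2 : g 2 = g 1 + (g 1 - g 0) := cycAdj_step _ _ _ s01 s12 (ne 0 2 (by decide))
  have t3 : g 3 = g 2 + (g 2 - g 1) := cycAdj_step _ _ _ s12 s23 (ne 1 3 (by decide))
  have t4 : g 4 = g 3 + (g 3 - g 2) := cycAdj_step _ _ _ s23 s34 (ne 2 4 (by decide))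
  have t5 : g 5 = g 4 + (g 4 - g 3) := cycAdj_step _ _ _ s34 s45 (ne 3 5 (by decide))
  rcases s01 with h1 | h1
  · left
    have h2 : g 2 = g 0 + 2 := by rw [t2, h1]; generalize g 0 = a; revert a; decide
    have h3 : g 3 = g 0 + 3 := by rw [t3, h2, h1]; generalize g 0 = a; revert a; decide
    have h4 : g 4 = g 0 + 4 := by rw [t4, h3, h2]; generalize g 0 = a; revert a; decide
    have h5 : g 5 = g 0 + 5 := by rw [t5, h4, h3]; generalize g 0 = a; revert a; decide
    intro k
    fin_cases k
    · simp
    · exact h1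
    · exact h2
    · exact h3
    · exact h4
    · exact h5
  · right
    have h2 : g 2 = g 0 - 2 := by rw [t2, h1]; generalize g 0 = a; revert a; decide
    have h3 : g 3 = g 0 - 3 := by rw [t3, h2, h1]; generalize g 0 = a; revert a; decide
    have h4 : g 4 = g 0 - 4 := by rw [t4, h3, h2]; generalize g 0 = a; revert a; decide
    have h5 : g 5 = g 0 - 5 := by rw [t5, h4, h3]; generalize g 0 = a; revert a; decide
    intro k
    fin_cases k
    · simp
    · exact h1
    · exact h2
    · exact h3
    · exact h4
    · exact h5

/-! ### ZD-2  Löschian directions, adjacency, and the twelve point-group maps -/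

/-- The six unit directions of the triangular lattice in Löschian coordinates, in cyclic order. -/
def loDir (k : Fin 6) : ℤ × ℤ :=
  ![((1 : ℤ), (0 : ℤ)), (0, 1), (-1, 1), (-1, 0), (0, -1), (1, -1)] k

/-- Lattice adjacency: `q` is a neighbour of `p`. -/
def LoAdj (p q : ℤ × ℤ) : Prop := ∃ k : Fin 6, q = p + loDir k

/-- `loDir_injective` (docstring added by the landing lane; see the module docstring). [formal bookkeeping] -/
theorem loDir_injective : Function.Injective loDir := by
  intro a b; revert a b; decide

/-- Two directions are adjacent sites iff their indices are cyclically adjacent. -/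
theorem loAdj_loDir_iff (k k' : Fin 6) : LoAdj (loDir k) (loDir k') ↔ CycAdj k k' := by
  unfold LoAdj; revert k k'; decide

/-- `loAdj_zero_iff` (docstring added by the landing lane; see the module docstring). [formal bookkeeping] -/
theorem loAdj_zero_iff (q : ℤ × ℤ) : LoAdj 0 q ↔ ∃ k, q = loDir k := by
  simp [LoAdj]

/-- The twelve point-group maps: `loDir 0 ↦ loDir j`, `loDir 1 ↦ loDir (j ± 1)`, extended `ℤ`-linearly. -/
def loRot (j : Fin 6) (ε : Bool) (p : ℤ × ℤ) : ℤ × ℤ :=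
  (p.1 * (loDir j).1 + p.2 * (loDir (if ε then j + 1 else j - 1)).1,
   p.1 * (loDir j).2 + p.2 * (loDir (if ε then j + 1 else j - 1)).2)

/-- `loRot_zero` (docstring added by the landing lane; see the module docstring). [formal bookkeeping] -/
theorem loRot_zero (j : Fin 6) (ε : Bool) : loRot j ε 0 = 0 := by
  simp [loRot]

/-- `loRot_add` (docstring added by the landing lane; see the module docstring). [formal bookkeeping] -/
theorem loRot_add (j : Fin 6) (ε : Bool) (p q : ℤ × ℤ) : loRot j ε (p + q) = loRot j ε p + loRot j ε q := by
  ext <;> simp [loRot] <;> ring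

/-- `loRot_sub` (docstring added by the landing lane; see the module docstring). [formal bookkeeping] -/
theorem loRot_sub (j : Fin 6) (ε : Bool) (p q : ℤ × ℤ) : loRot j ε (p - q) = loRot j ε p - loRot j ε q := by
  ext <;> simp [loRot] <;> ring

/-- `loRot_loDir_true` (docstring added by the landing lane; see the module docstring). [formal bookkeeping] -/
theorem loRot_loDir_true (j k : Fin 6) : loRot j true (loDir k) = loDir (j + k) := by
  revert j k; decide

/-- `loRot_loDir_false` (docstring added by the landing lane; see the module docstring). [formal bookkeeping] -/
theorem loRot_loDir_false (j k : Fin 6) : loRot j false (loDir k) = loDir (j - k) := by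
  revert j k; decide

/-- Point-group maps preserve adjacency. -/
theorem loAdj_loRot (j : Fin 6) (ε : Bool) {p q : ℤ × ℤ} (h : LoAdj p q) : LoAdj (loRot j ε p) (loRot j ε q) := by
  obtain ⟨k, rfl⟩ := h
  cases ε
  · exact ⟨j - k, by rw [loRot_add, loRot_loDir_false]⟩
  · exact ⟨j + k, by rw [loRot_add, loRot_loDir_true]⟩

/-! ### ZD-3  ★ The hexagon kernel -/

/-- ★ **HEXAGON RIGIDITY.**  A map fixing `0`, sending the six neighbours of `0` injectively to neighbours of `0`, and
preserving adjacency among them, agrees on the star of `0` with one of the twelve point-group maps `loRot j ε`. -/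
theorem hexagon_rigidity (f : ℤ × ℤ → ℤ × ℤ)
    (hN : ∀ k : Fin 6, LoAdj 0 (f (loDir k)))
    (hA : ∀ k k' : Fin 6, LoAdj (loDir k) (loDir k') → LoAdj (f (loDir k)) (f (loDir k')))
    (hI : ∀ k k' : Fin 6, f (loDir k) = f (loDir k') → k = k') :
    ∃ j : Fin 6, ∃ ε : Bool, ∀ k, f (loDir k) = loRot j ε (loDir k) := by
  have hg : ∀ k, ∃ m : Fin 6, f (loDir k) = loDir m := fun k => (loAdj_zero_iff _).1 (hN k)
  choose g hg using hg
  have ginj : Function.Injective g := by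
    intro k k' h
    exact hI k k' (by rw [hg k, hg k', h])
  have gadj : ∀ k, CycAdj (g k) (g (k + 1)) := by
    intro k
    have h := hA k (k + 1) ((loAdj_loDir_iff _ _).2 (cycAdj_succ k))
    rw [hg k, hg (k + 1)] at h
    exact (loAdj_loDir_iff _ _).1 h
  rcases dihedral_of_cycHom g ginj gadj with h | h
  · exact ⟨g 0, true, fun k => by rw [hg k, h k, loRot_loDir_true]⟩
  · exact ⟨g 0, false, fun k => by rw [hg k, h k, loRot_loDir_false]⟩

/-- The same, for a star centred anywhere and a map that need not fix the centre: `f` is point-group-AFFINE on the star. -/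
theorem hexagon_rigidity_at (f : ℤ × ℤ → ℤ × ℤ) (c : ℤ × ℤ)
    (hN : ∀ k : Fin 6, LoAdj (f c) (f (c + loDir k)))
    (hA : ∀ k k' : Fin 6, LoAdj (loDir k) (loDir k') → LoAdj (f (c + loDir k)) (f (c + loDir k')))
    (hI : ∀ k k' : Fin 6, f (c + loDir k) = f (c + loDir k') → k = k') :
    ∃ j : Fin 6, ∃ ε : Bool, ∀ k, f (c + loDir k) = f c + loRot j ε (loDir k) := by
  set F : ℤ × ℤ → ℤ × ℤ := fun p => f (c + p) - f c with hF
  have hN' : ∀ k : Fin 6, LoAdj 0 (F (loDir k)) := fun k => by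
    obtain ⟨m, hm⟩ := hN k
    refine ⟨m, ?_⟩
    show f (c + loDir k) - f c = 0 + loDir m
    rw [hm]; abel
  have hA' : ∀ k k' : Fin 6, LoAdj (loDir k) (loDir k') → LoAdj (F (loDir k)) (F (loDir k')) := fun k k' hkk => by
    obtain ⟨m, hm⟩ := hA k k' hkk
    refine ⟨m, ?_⟩
    show f (c + loDir k') - f c = f (c + loDir k) - f c + loDir m
    rw [hm]; abel
  have hI' : ∀ k k' : Fin 6, F (loDir k) = F (loDir k') → k = k' := fun k k' h =>
    hI k k' (sub_left_injective h)
  obtain ⟨j, ε, h⟩ := hexagon_rigidity F hN' hA' hI'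
  refine ⟨j, ε, fun k => ?_⟩
  have hk : f (c + loDir k) - f c = loRot j ε (loDir k) := h k
  rw [← hk]; abel

/-! ### ZD-4  Pinning -/

/-- A point-group map is determined by its values on two consecutive directions. -/
theorem loRot_ext_pair (j j' : Fin 6) (ε ε' : Bool) (k : Fin 6)
    (h1 : loRot j ε (loDir k) = loRot j' ε' (loDir k))
    (h2 : loRot j ε (loDir (k + 1)) = loRot j' ε' (loDir (k + 1))) : j = j' ∧ ε = ε' := by
  revert j j' ε ε' k h1 h2; decide

/-- Two consecutive directions form a `ℤ`-basis: every site is an integer combination of `loDir k`, `loDir (k+1)`. -/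
theorem loDir_basis (k : Fin 6) (p : ℤ × ℤ) :
    ∃ a b : ℤ, p = (a * (loDir k).1 + b * (loDir (k + 1)).1, a * (loDir k).2 + b * (loDir (k + 1)).2) := by
  fin_cases k
  · exact ⟨p.1, p.2, by ext <;> simp [loDir]⟩
  · exact ⟨p.1 + p.2, -p.1, by ext <;> simp [loDir]⟩
  · exact ⟨p.2, -p.1 - p.2, by ext <;> simp [loDir]⟩
  · exact ⟨-p.1, -p.2, by ext <;> simp [loDir]⟩
  · exact ⟨-p.1 - p.2, p.1, by ext <;> simp [loDir]⟩
  · exact ⟨-p.2, p.1 + p.2, by ext <;> simp [loDir]⟩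

/-- ★ **AFFINE PINNING.**  Two point-group-affine maps that agree on a lattice triangle `{t, t + loDir k, t + loDir (k+1)}`
agree everywhere.  (The gluing step of the triangle-connected rigidity induction.) -/
theorem affine_pinning (c c' t : ℤ × ℤ) (j j' : Fin 6) (ε ε' : Bool) (k : Fin 6)
    (h0 : c + loRot j ε t = c' + loRot j' ε' t)
    (h1 : c + loRot j ε (t + loDir k) = c' + loRot j' ε' (t + loDir k))
    (h2 : c + loRot j ε (t + loDir (k + 1)) = c' + loRot j' ε' (t + loDir (k + 1))) :
    c = c' ∧ j = j' ∧ ε = ε' := by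
  simp only [loRot_add, ← add_assoc] at h1 h2
  rw [h0] at h1 h2
  have e1 : loRot j ε (loDir k) = loRot j' ε' (loDir k) := add_left_cancel h1
  have e2 : loRot j ε (loDir (k + 1)) = loRot j' ε' (loDir (k + 1)) := add_left_cancel h2
  obtain ⟨rfl, rfl⟩ := loRot_ext_pair j j' ε ε' k e1 e2
  exact ⟨by simpa using h0, rfl, rfl⟩

/-! ### ZD-5  ★ Propagation: rigidity is global on star-interior-connected regions -/

/-- The closed star of a site: the site and its six neighbours. -/
def loStar (c : ℤ × ℤ) : Set (ℤ × ℤ) := {p | p = c ∨ ∃ k : Fin 6, p = c + loDir k}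

/-- `self_mem_loStar` (docstring added by the landing lane; see the module docstring). [formal bookkeeping] -/
theorem self_mem_loStar (c : ℤ × ℤ) : c ∈ loStar c := Or.inl rfl

/-- `add_loDir_mem_loStar` (docstring added by the landing lane; see the module docstring). [formal bookkeeping] -/
theorem add_loDir_mem_loStar (c : ℤ × ℤ) (k : Fin 6) : c + loDir k ∈ loStar c := Or.inr ⟨k, rfl⟩

/-- `loDir_add_three` (docstring added by the landing lane; see the module docstring). [formal bookkeeping] -/
theorem loDir_add_three (k : Fin 6) : loDir k + loDir (k + 3) = 0 := by
  revert k; decide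

/-- `loDir_succ_eq` (docstring added by the landing lane; see the module docstring). [formal bookkeeping] -/
theorem loDir_succ_eq (k : Fin 6) : loDir (k + 1) = loDir k + loDir (k + 2) := by
  revert k; decide

/-- The centre of a star lies in the star of each of its neighbours. -/
theorem self_mem_loStar_add (c : ℤ × ℤ) (k : Fin 6) : c ∈ loStar (c + loDir k) :=
  Or.inr ⟨k + 3, by rw [add_assoc, loDir_add_three, add_zero]⟩

/-- The third vertex `c + loDir (k+1)` of the lattice triangle on the bond `c — c + loDir k` lies in both stars. -/
theorem add_loDir_succ_mem_loStar_add (c : ℤ × ℤ) (k : Fin 6) : c + loDir (k + 1) ∈ loStar (c + loDir k) :=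
  Or.inr ⟨k + 2, by rw [add_assoc, ← loDir_succ_eq]⟩

/-- LOCAL STEP.  A bond-preserving map, injective on `R`, is point-group-affine on every closed star contained in `R`. -/
theorem affine_on_loStar (f : ℤ × ℤ → ℤ × ℤ) (R : Set (ℤ × ℤ))
    (hB : ∀ p ∈ R, ∀ q ∈ R, LoAdj p q → LoAdj (f p) (f q)) (hI : Set.InjOn f R)
    (c : ℤ × ℤ) (hc : loStar c ⊆ R) :
    ∃ a : ℤ × ℤ, ∃ j : Fin 6, ∃ ε : Bool, ∀ p ∈ loStar c, f p = a + loRot j ε p := by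
  have hcR : c ∈ R := hc (self_mem_loStar c)
  have hkR : ∀ k, c + loDir k ∈ R := fun k => hc (add_loDir_mem_loStar c k)
  obtain ⟨j, ε, h⟩ := hexagon_rigidity_at f c
    (fun k => hB c hcR _ (hkR k) ⟨k, rfl⟩)
    (fun k k' hkk => by
      obtain ⟨m, hm⟩ := hkk
      exact hB _ (hkR k) _ (hkR k') ⟨m, by rw [hm, add_assoc]⟩)
    (fun k k' hfk => loDir_injective (add_left_cancel (hI (hkR k) (hkR k') hfk)))
  refine ⟨f c - loRot j ε c, j, ε, fun p hp => ?_⟩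
  rcases hp with rfl | ⟨k, rfl⟩
  · abel
  · rw [h k, loRot_add]; abel

/-- GLUING STEP.  The affine descriptions on the stars of two adjacent centres coincide. -/
theorem affine_unique_adjacent (f : ℤ × ℤ → ℤ × ℤ) (c : ℤ × ℤ) (k : Fin 6)
    (a a' : ℤ × ℤ) (j j' : Fin 6) (ε ε' : Bool)
    (h : ∀ p ∈ loStar c, f p = a + loRot j ε p)
    (h' : ∀ p ∈ loStar (c + loDir k), f p = a' + loRot j' ε' p) :
    a = a' ∧ j = j' ∧ ε = ε' :=
  affine_pinning a a' c j j' ε ε' k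
    (by rw [← h c (self_mem_loStar c), ← h' c (self_mem_loStar_add c k)])
    (by rw [← h _ (add_loDir_mem_loStar c k), ← h' _ (self_mem_loStar _)])
    (by rw [← h _ (add_loDir_mem_loStar c (k + 1)), ← h' _ (add_loDir_succ_mem_loStar_add c k)])

/-- Star-interior adjacency inside `R`: a bond both of whose closed stars lie in `R`. -/
def StarAdj (R : Set (ℤ × ℤ)) (p q : ℤ × ℤ) : Prop := LoAdj p q ∧ loStar p ⊆ R ∧ loStar q ⊆ R

/-- ★★ **LATTICE RIGIDITY (propagation form).**  Let `f` be bond-preserving and injective on `R ⊆ ℤ × ℤ`.  The point-group-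
affine map that `f` equals on the closed star of `c₀` (it exists by `affine_on_loStar`) is the SAME on the closed star of every
site reachable from `c₀` through bonds whose endpoints have their closed stars inside `R`.  In words: on a star-interior-connected
region a bond-preserving injective map into the triangular lattice is the restriction of ONE lattice isometry — the
configuration-free half of (GL) `BondLabelP` (NODE 77; critic row 1377 (iv)): no holonomy, annuli included. -/
theorem lattice_rigidity (f : ℤ × ℤ → ℤ × ℤ) (R : Set (ℤ × ℤ))
    (hB : ∀ p ∈ R, ∀ q ∈ R, LoAdj p q → LoAdj (f p) (f q)) (hI : Set.InjOn f R)
    (a : ℤ × ℤ) (j : Fin 6) (ε : Bool) {c₀ c : ℤ × ℤ}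
    (ha : ∀ p ∈ loStar c₀, f p = a + loRot j ε p)
    (hpath : Relation.ReflTransGen (StarAdj R) c₀ c) :
    ∀ p ∈ loStar c, f p = a + loRot j ε p := by
  induction hpath with
  | refl => exact ha
  | tail _ hbc ih =>
    obtain ⟨⟨k, rfl⟩, _, hc⟩ := hbc
    obtain ⟨a', j', ε', h'⟩ := affine_on_loStar f R hB hI _ hc
    obtain ⟨rfl, rfl, rfl⟩ := affine_unique_adjacent f _ k a a' j j' ε ε' ih h'
    exact h'

/-- ★★ Existence form: along a star-interior-connected family of centres there is ONE point-group-affine map (`a`, `loRot j ε`)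
that `f` restricts to on all their closed stars. -/
theorem lattice_rigidity_exists (f : ℤ × ℤ → ℤ × ℤ) (R : Set (ℤ × ℤ))
    (hB : ∀ p ∈ R, ∀ q ∈ R, LoAdj p q → LoAdj (f p) (f q)) (hI : Set.InjOn f R)
    (c₀ : ℤ × ℤ) (h0 : loStar c₀ ⊆ R) :
    ∃ a : ℤ × ℤ, ∃ j : Fin 6, ∃ ε : Bool,
      ∀ c, Relation.ReflTransGen (StarAdj R) c₀ c → ∀ p ∈ loStar c, f p = a + loRot j ε p := by
  obtain ⟨a, j, ε, ha⟩ := affine_on_loStar f R hB hI c₀ h0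
  exact ⟨a, j, ε, fun c hc => lattice_rigidity f R hB hI a j ε ha hc⟩

end Summit.AtomisticToContinuum.Crystallization.Theorems.ChartedZeroExcessLayeredLatticeLiouville
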